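import Mathlib
import Summits.Ventures.PercRepro2.Independence
import Summits.Ventures.PercRepro2.Harris
import Summits.Ventures.PercRepro2.HCov
import Summits.Ventures.PercRepro2.CutVertexPaths
import Summits.Ventures.PercRepro2.CutOneFarConn
import Summits.Ventures.PercRepro2.CutTwoFarConn
import Summits.Ventures.PercRepro2.CutTwoFarLaw
import Summits.Ventures.PercRepro2.CutTwoFar
import Summits.Ventures.PercRepro2.CutTwoFarHarris
import Summits.Ventures.PercRepro2.CutTwoFarRootsLaw
import Summits.Ventures.PercRepro2.CutTwoFarRightPat

/-!
# A root and `a₃` behind a cut vertex, I: MARK CONNECTIVITY (blind cell PercRepro2, typer-1 g51)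

With `v` a cut vertex, `a₁, a₃` on the left and `a₂, o, b` on the right (or at `v`), every
connection between two marks is a Boolean function of the left pattern of `{v, a₁, a₃}` (`pat`) and
the right pattern of `{v, a₂, o, b}` (`rpat`, with `y₁ = a₂`, `y₂ = o`, `y₃ = b`) (`a13_conn_*`).
Part I of the class T5 of MINE2-CUTVERTEX §13.9 / §13.12 (S3.5, the role pair `{a₁, a₃}`; the
mirror `{a₂, a₃}` by the root symmetry).  Own work; standard axioms.
-/

namespace Summit.Ventures.PercRepro2

open CovForm CutVertexM9 UnionCluster

namespace CutTwoFar

section A13Conn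

variable {V : Type*} {E : Type*} [Fintype E] [DecidableEq E] {R : Type*} [Field R]
variable {ends : E → Sym2 V} {side : E → Bool} {L : Set V} {v : V} {Rt : Set V}

variable (h : CutVertex ends side L v Rt) {o b a₁ a₂ a₃ : V}
include h

omit [Fintype E] [DecidableEq E] in
/-- `a₁ ↔ o`: the left bit `a₁ ↔ v` and the right bit `v ↔ o`. -/
lemma a13_conn_a₁_o (h1 : a₁ ∈ L ∨ a₁ = v) (ho : o ∈ Rt ∨ o = v) (ω : Config E) :
    Conn ends ω a₁ o ↔ pat ends side v a₁ a₃ ω 0 = true ∧ rpat ends side v a₂ o b ω 1 = true := by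
  rw [conn_left_right_iff h h1 ho ω, pat_zero_iff, Rb_eq_true_iff, rpat_one_iff]

omit [Fintype E] [DecidableEq E] in
/-- `a₁ ↔ b`: the left bit `a₁ ↔ v` and the right bit `v ↔ b`. -/
lemma a13_conn_a₁_b (h1 : a₁ ∈ L ∨ a₁ = v) (hb : b ∈ Rt ∨ b = v) (ω : Config E) :
    Conn ends ω a₁ b ↔ pat ends side v a₁ a₃ ω 0 = true ∧ rpat ends side v a₂ o b ω 2 = true := by
  rw [conn_left_right_iff h h1 hb ω, pat_zero_iff, Rb_eq_true_iff, rpat_two_iff]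

omit [Fintype E] [DecidableEq E] in
/-- `a₁ ↔ a₂`: the left bit `a₁ ↔ v` and the right bit `v ↔ a₂`. -/
lemma a13_conn_a₁_a₂ (h1 : a₁ ∈ L ∨ a₁ = v) (h2 : a₂ ∈ Rt ∨ a₂ = v) (ω : Config E) :
    Conn ends ω a₁ a₂ ↔ pat ends side v a₁ a₃ ω 0 = true ∧ rpat ends side v a₂ o b ω 0 = true := by
  rw [conn_left_right_iff h h1 h2 ω, pat_zero_iff, Rb_eq_true_iff, rpat_zero_iff]

omit [Fintype E] [DecidableEq E] in
/-- `a₂ ↔ a₁`, mirror. -/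
lemma a13_conn_a₂_a₁ (h1 : a₁ ∈ L ∨ a₁ = v) (h2 : a₂ ∈ Rt ∨ a₂ = v) (ω : Config E) :
    Conn ends ω a₂ a₁ ↔ pat ends side v a₁ a₃ ω 0 = true ∧ rpat ends side v a₂ o b ω 0 = true := by
  rw [show Conn ends ω a₂ a₁ ↔ Conn ends ω a₁ a₂ from ⟨conn_symm, conn_symm⟩,
    conn_left_right_iff h h1 h2 ω, pat_zero_iff, Rb_eq_true_iff, rpat_zero_iff]

omit [Fintype E] [DecidableEq E] in
/-- `a₃ ↔ a₂`: the left bit `a₃ ↔ v` and the right bit `v ↔ a₂`. -/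
lemma a13_conn_a₃_a₂ (h2 : a₂ ∈ Rt ∨ a₂ = v) (h3 : a₃ ∈ L ∨ a₃ = v) (ω : Config E) :
    Conn ends ω a₃ a₂ ↔ pat ends side v a₁ a₃ ω 1 = true ∧ rpat ends side v a₂ o b ω 0 = true := by
  rw [conn_left_right_iff h h3 h2 ω, pat_one_iff, Rb_eq_true_iff, rpat_zero_iff]

omit [Fintype E] [DecidableEq E] in
/-- `a₂ ↔ a₃`, mirror. -/
lemma a13_conn_a₂_a₃ (h2 : a₂ ∈ Rt ∨ a₂ = v) (h3 : a₃ ∈ L ∨ a₃ = v) (ω : Config E) :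
    Conn ends ω a₂ a₃ ↔ pat ends side v a₁ a₃ ω 1 = true ∧ rpat ends side v a₂ o b ω 0 = true := by
  rw [show Conn ends ω a₂ a₃ ↔ Conn ends ω a₃ a₂ from ⟨conn_symm, conn_symm⟩,
    conn_left_right_iff h h3 h2 ω, pat_one_iff, Rb_eq_true_iff, rpat_zero_iff]

omit [Fintype E] [DecidableEq E] in
/-- `a₁ ↔ a₃`: the left bit `2`. -/
lemma a13_conn_a₁_a₃ (h1 : a₁ ∈ L ∨ a₁ = v) (h3 : a₃ ∈ L ∨ a₃ = v) (ω : Config E) :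
    Conn ends ω a₁ a₃ ↔ pat ends side v a₁ a₃ ω 2 = true := by
  rw [conn_iff_restrict_left h h1 h3 ω, pat_two_iff]

omit [Fintype E] [DecidableEq E] in
/-- `a₃ ↔ a₁`, mirror. -/
lemma a13_conn_a₃_a₁ (h1 : a₁ ∈ L ∨ a₁ = v) (h3 : a₃ ∈ L ∨ a₃ = v) (ω : Config E) :
    Conn ends ω a₃ a₁ ↔ pat ends side v a₁ a₃ ω 2 = true := by
  rw [show Conn ends ω a₃ a₁ ↔ Conn ends ω a₁ a₃ from ⟨conn_symm, conn_symm⟩,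
    conn_iff_restrict_left h h1 h3 ω, pat_two_iff]

omit [Fintype E] [DecidableEq E] in
/-- `a₁ ↔ v`: the left bit `0`. -/
lemma a13_conn_a₁_v (h1 : a₁ ∈ L ∨ a₁ = v) (ω : Config E) :
    Conn ends ω a₁ v ↔ pat ends side v a₁ a₃ ω 0 = true := by
  rw [conn_iff_restrict_left h h1 (Or.inr rfl) ω, pat_zero_iff]

omit [Fintype E] [DecidableEq E] in
/-- `a₃ ↔ v`: the left bit `1`. -/
lemma a13_conn_a₃_v (h3 : a₃ ∈ L ∨ a₃ = v) (ω : Config E) :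
    Conn ends ω a₃ v ↔ pat ends side v a₁ a₃ ω 1 = true := by
  rw [conn_iff_restrict_left h h3 (Or.inr rfl) ω, pat_one_iff]

omit [Fintype E] [DecidableEq E] in
/-- `a₂ ↔ o`: the right bit `3`. -/
lemma a13_conn_a₂_o (h2 : a₂ ∈ Rt ∨ a₂ = v) (ho : o ∈ Rt ∨ o = v) (ω : Config E) :
    Conn ends ω a₂ o ↔ rpat ends side v a₂ o b ω 3 = true := by
  rw [conn_right_iff h h2 ho ω, rpat_three_iff]

omit [Fintype E] [DecidableEq E] in
/-- `o ↔ a₂`, mirror. -/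
lemma a13_conn_o_a₂ (h2 : a₂ ∈ Rt ∨ a₂ = v) (ho : o ∈ Rt ∨ o = v) (ω : Config E) :
    Conn ends ω o a₂ ↔ rpat ends side v a₂ o b ω 3 = true := by
  rw [conn_right_iff h ho h2 ω, rpat_three_iff]
  exact ⟨conn_symm, conn_symm⟩

omit [Fintype E] [DecidableEq E] in
/-- `a₂ ↔ b`: the right bit `4`. -/
lemma a13_conn_a₂_b (h2 : a₂ ∈ Rt ∨ a₂ = v) (hb : b ∈ Rt ∨ b = v) (ω : Config E) :
    Conn ends ω a₂ b ↔ rpat ends side v a₂ o b ω 4 = true := by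
  rw [conn_right_iff h h2 hb ω, rpat_four_iff]

omit [Fintype E] [DecidableEq E] in
/-- `o ↔ b`: the right bit `5`. -/
lemma a13_conn_o_b (ho : o ∈ Rt ∨ o = v) (hb : b ∈ Rt ∨ b = v) (ω : Config E) :
    Conn ends ω o b ↔ rpat ends side v a₂ o b ω 5 = true := by
  rw [conn_right_iff h ho hb ω, rpat_five_iff]

omit [Fintype E] [DecidableEq E] in
/-- `a₂ ↔ v`: the right bit `0`. -/
lemma a13_conn_a₂_v (h2 : a₂ ∈ Rt ∨ a₂ = v) (ω : Config E) :
    Conn ends ω a₂ v ↔ rpat ends side v a₂ o b ω 0 = true := by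
  rw [conn_right_iff h h2 (Or.inr rfl) ω, rpat_zero_iff]
  exact ⟨conn_symm, conn_symm⟩

omit [Fintype E] [DecidableEq E] in
/-- `v ↔ a₂`: the right bit `0`. -/
lemma a13_conn_v_a₂ (h2 : a₂ ∈ Rt ∨ a₂ = v) (ω : Config E) :
    Conn ends ω v a₂ ↔ rpat ends side v a₂ o b ω 0 = true := by
  rw [conn_right_iff h (Or.inr rfl) h2 ω, rpat_zero_iff]

omit [Fintype E] [DecidableEq E] in
/-- `o ↔ v`: the right bit `1`. -/
lemma a13_conn_o_v (ho : o ∈ Rt ∨ o = v) (ω : Config E) :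
    Conn ends ω o v ↔ rpat ends side v a₂ o b ω 1 = true := by
  rw [conn_right_iff h ho (Or.inr rfl) ω, rpat_one_iff]
  exact ⟨conn_symm, conn_symm⟩

omit [Fintype E] [DecidableEq E] in
/-- `v ↔ o`: the right bit `1`. -/
lemma a13_conn_v_o (ho : o ∈ Rt ∨ o = v) (ω : Config E) :
    Conn ends ω v o ↔ rpat ends side v a₂ o b ω 1 = true := by
  rw [conn_right_iff h (Or.inr rfl) ho ω, rpat_one_iff]

omit [Fintype E] [DecidableEq E] in
/-- `b ↔ v`: the right bit `2`. -/
lemma a13_conn_b_v (hb : b ∈ Rt ∨ b = v) (ω : Config E) :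
    Conn ends ω b v ↔ rpat ends side v a₂ o b ω 2 = true := by
  rw [conn_right_iff h hb (Or.inr rfl) ω, rpat_two_iff]
  exact ⟨conn_symm, conn_symm⟩

omit [Fintype E] [DecidableEq E] in
/-- `v ↔ b`: the right bit `2`. -/
lemma a13_conn_v_b (hb : b ∈ Rt ∨ b = v) (ω : Config E) :
    Conn ends ω v b ↔ rpat ends side v a₂ o b ω 2 = true := by
  rw [conn_right_iff h (Or.inr rfl) hb ω, rpat_two_iff]

end A13Conn

end CutTwoFar

end Summit.Ventures.PercRepro2
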